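import Summits.BirchSwinnertonDyer.BirchSwinnertonDyer.Theorems.DerivedKatoValuationDoorIntegralH1RankLeTwoOfAnalyticRankTwoCrisAtOfPoint
import Summits.BirchSwinnertonDyer.BirchSwinnertonDyer.Theorems.DerivedKatoValuationDoorIntegralH1RankLeTwoOfAnalyticRankTwoStubRankLeSelmerCorank
import Summits.BirchSwinnertonDyer.BirchSwinnertonDyer.Theses.SelmerRank
import HarnessLib

/-!
# The (β) crux S2 `IntegralH1RankLeTwoOfAnalyticRankTwo` (stmt-BirchSwinnertonDyer-23752) BY NAME from existing items, with NO print debt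
# (LEAD bsd-line-dkd-p1 g4, line `birth` r5; helper, closes nothing)

After the INPUTS desk's landing of the dictionary-≤ stub as a THEOREM (`stub_rankIntegralH1LeSelmerCorankAtDoor`, honda-p1 g14,
p679321: at a door prime, under ε, `rank_{ℤ_p} H¹(ℤ[1/p], T_pW) ≤ corank Sel_{p^∞}(W/ℚ)`, unconditional), the registered skeleton of line
`birth` has TWO stubs left — N1∣_door (`stub_selCapTwoAtDoorOfAnalyticRankTwo`, the research stub) and ε (`stub_crisAtDoorPrimes` = item 23148,
closed given `PointsTwo` by `crisAtDoorPrimes_of_pointsTwo`) — and its composition is print-free.  Recorded here as landed theorems: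

* §1 `integralH1RankLeTwoOfAnalyticRankTwo_of_selCapTwoAtDoor_of_crisAt` — **S2 ⟸ N1∣_door ∧ ε**, unconditional (the skeleton's composition);
  `integralH1RankLeTwoOfAnalyticRankTwo_of_selCapTwoAtDoor_of_pointsTwo` — **S2 ⟸ N1∣_door ∧ `PointsTwo`** (the route's own residual, stmt-23026):
  inside route DerivedKatoValuationDoor the deciding crux now carries NO content beyond the node N1∣_door — not even print.
* §2 `integralH1RankLeTwoOfAnalyticRankTwo_of_selmerRankUB_of_pointsTwo` — **S2 ⟸ `SelmerRank.SelmerRankUB` (stmt-0130) ∧ `PointsTwo`**, and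
  `…_of_selmerRankRankTwo_of_pointsTwo` — **S2 ⟸ `SelmerRank.SelmerRankRankTwo` (stmt-0129) ∧ `PointsTwo`**, BY NAME, no named fact.
* §3 `integralH1RankLeTwoOfAnalyticRankTwo_of_summit_of_shaPFinite` — **S2 ⟸ the summit `BirchSwinnertonDyer` ∧ `SelmerRank.SelmerRankShaPFinite`
  (stmt-0132)**, BY NAME, no named fact (`PointsTwo` and N1∣_door both follow from `a = r` and `Ш[p^∞]` finite via Greenberg's identity): the
  crux is a consequence of the standard conjectures — in particular it is not refutable short of `¬`BSD-rank or an infinite `Ш[p^∞]`.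

Nothing here proves S2, N1∣_door, ε, `PointsTwo`, any SelmerRank item or BSD.  Helper for stmt-BirchSwinnertonDyer-23752.

References: [cite: PerrinRiou1993AIF, Lemme 2.3.9 (p. 967)]; [cite: KuriharaPollack2007, §1.4 Lemma 1.4]; [cite: GreenbergLNM1716, §1 (pp. 53, 63)];
[cite: Kato2004Asterisque, §14.1 and Thm. 18.4].
-/

set_option linter.dupNamespace false
set_option autoImplicit false

noncomputable section

open scoped Classical

namespace Summit.BirchSwinnertonDyer.BirchSwinnertonDyer.Theorems.DerivedKatoValuationDoor

open Field
open Literature Literature.NumberTheory.GaloisRepresentations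
open Literature.NumberTheory.EllipticCurves Literature.NumberTheory.EllipticCurves.Kato2004
open Literature.NumberTheory.EllipticCurves.Kato2004.EulerSystemValues
open Summit.BirchSwinnertonDyer.BirchSwinnertonDyer.Theses.DerivedKatoValuationDoor
  (CrisAtDoorPrimes PointsTwo IntegralH1RankLeTwoOfAnalyticRankTwo)
open Summit.BirchSwinnertonDyer.BirchSwinnertonDyer.Theses.SelmerRank (SelmerRankUB SelmerRankRankTwo SelmerRankShaPFinite)

/-! ## §1 S2 from N1∣_door and ε — print-free -/

/-- **S2 ⟸ N1∣_door ∧ ε, UNCONDITIONALLY** (the composition of the registered skeleton `Lines/birth.lean` r5): at a door cell of an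
analytic-rank-two curve, ε feeds the landed dictionary-≤ theorem `stub_rankIntegralH1LeSelmerCorankAtDoor` (`rank H¹(ℤ[1/p],T_pW) ≤ s_p`)
and N1∣_door caps `s_p ≤ 2`.  Both hypotheses are OPEN (N1∣_door BSD-strength; ε open only on the phantom cell `a = 2 ∧ r = 0`).
[cite: PerrinRiou1993AIF, Lemme 2.3.9 (p. 967)] [cite: KuriharaPollack2007, §1.4 Lemma 1.4] -/
theorem integralH1RankLeTwoOfAnalyticRankTwo_of_selCapTwoAtDoor_of_crisAt
    (hSel : ∀ (W : WeierstrassCurve ℚ) [W.IsElliptic] [W.IsGloballyMinimal] (p : ℕ) [Fact p.Prime],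
      W.analyticRank = 2 →
        (5 ≤ p ∧ Literature.NumberTheory.EllipticCurves.IsOrdinaryAt W p ∧ W.HasSurjectiveModNGaloisRep p) →
          W.selmerCorank p ≤ 2)
    (hCris : CrisAtDoorPrimes) : IntegralH1RankLeTwoOfAnalyticRankTwo := by
  intro W _ _ p _ _ ha hdoor
  have h1 : Module.rank ℤ_[p] ↥(integralH1 (tateRep W p) p ⊤) ≤ (W.selmerCorank p : Cardinal) :=
    stub_rankIntegralH1LeSelmerCorankAtDoor W p hdoor (hCris W p ha hdoor)
  have h2 : (W.selmerCorank p : Cardinal) ≤ 2 := by exact_mod_cast hSel W p ha hdoor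
  exact h1.trans h2

/-- **S2 ⟸ N1∣_door ∧ `PointsTwo`, print-free** (ε from one rational point of infinite order, `crisAtDoorPrimes_of_pointsTwo`, p675908).
Inside the route, whose `closes` already binds `PointsTwo` (stmt-23026), the deciding crux S2 is therefore EXACTLY the node N1∣_door.
[cite: BlochKato1990, Ex. 3.11] [cite: PerrinRiou1993AIF, Lemme 2.3.9 (p. 967)] -/
theorem integralH1RankLeTwoOfAnalyticRankTwo_of_selCapTwoAtDoor_of_pointsTwo
    (hSel : ∀ (W : WeierstrassCurve ℚ) [W.IsElliptic] [W.IsGloballyMinimal] (p : ℕ) [Fact p.Prime],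
      W.analyticRank = 2 →
        (5 ≤ p ∧ Literature.NumberTheory.EllipticCurves.IsOrdinaryAt W p ∧ W.HasSurjectiveModNGaloisRep p) →
          W.selmerCorank p ≤ 2)
    (hPts : PointsTwo) : IntegralH1RankLeTwoOfAnalyticRankTwo :=
  integralH1RankLeTwoOfAnalyticRankTwo_of_selCapTwoAtDoor_of_crisAt hSel (crisAtDoorPrimes_of_pointsTwo hPts)

/-! ## §2 S2 from the SelmerRank node items and `PointsTwo` — by name, print-free -/

/-- **S2 ⟸ `SelmerRankUB` (stmt-BirchSwinnertonDyer-0130) ∧ `PointsTwo` (stmt-BirchSwinnertonDyer-23026), BY NAME, no named fact**: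
N1∣_door is the `a = 2` slice of `SelmerRankUB` (`s_p ≤ a` at big-image good ordinary `p ≥ 5`; `IsOrdinaryAt ↔ good ∧ p ∤ a_p`).
Both hypotheses are OPEN items of the tree. [cite: GreenbergLNM1716, §1 (p. 63)] -/
theorem integralH1RankLeTwoOfAnalyticRankTwo_of_selmerRankUB_of_pointsTwo (hUB : SelmerRankUB) (hPts : PointsTwo) :
    IntegralH1RankLeTwoOfAnalyticRankTwo := by
  refine integralH1RankLeTwoOfAnalyticRankTwo_of_selCapTwoAtDoor_of_pointsTwo ?_ hPts
  intro W _ _ p _ ha hdoor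
  obtain ⟨h5, hord, hsurj⟩ := hdoor
  have hgo := (isOrdinaryAt_iff W p).1 hord
  have h := hUB W p h5 hgo.1 hgo.2 hsurj
  omega

/-- **S2 ⟸ `SelmerRankRankTwo` (stmt-BirchSwinnertonDyer-0129) ∧ `PointsTwo`, BY NAME, no named fact** (only the ← half
«`a = 2 ⇒ s_p = 2`» of 0129 is used). [cite: GreenbergLNM1716, §1 (p. 63)] -/
theorem integralH1RankLeTwoOfAnalyticRankTwo_of_selmerRankRankTwo_of_pointsTwo (h2 : SelmerRankRankTwo) (hPts : PointsTwo) :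
    IntegralH1RankLeTwoOfAnalyticRankTwo := by
  refine integralH1RankLeTwoOfAnalyticRankTwo_of_selCapTwoAtDoor_of_pointsTwo ?_ hPts
  intro W _ _ p _ ha hdoor
  obtain ⟨h5, hord, hsurj⟩ := hdoor
  have hgo := (isOrdinaryAt_iff W p).1 hord
  exact ((h2 W p h5 hgo.1 hgo.2 hsurj).2 ha).le

/-! ## §3 S2 from the standard conjectures — by name, print-free -/

/-- **S2 ⟸ the summit `BirchSwinnertonDyer` ∧ `SelmerRankShaPFinite` (stmt-BirchSwinnertonDyer-0132), BY NAME, no named fact**: with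
`a = r` everywhere and `Ш(W)[p^∞]` finite for all `(W, p)`, Greenberg's identity (tree theorem `selmerCorank_eq_mordellWeilRank_add_holds`,
with `shaCorank_eq_zero_of_finite`) gives `s_p = a`, hence N1∣_door, and `a = 2 ⇒ r = 2` gives `PointsTwo`.  So the crux is a consequence of
the standard conjectures (not refutable short of `¬`BSD-rank at some curve or an infinite `Ш[p^∞]`). [cite: GreenbergLNM1716, §1 (pp. 53, 63)] -/
theorem integralH1RankLeTwoOfAnalyticRankTwo_of_summit_of_shaPFinite (hS : _root_.BirchSwinnertonDyer)
    (hSha : SelmerRankShaPFinite) : IntegralH1RankLeTwoOfAnalyticRankTwo := by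
  refine integralH1RankLeTwoOfAnalyticRankTwo_of_selCapTwoAtDoor_of_pointsTwo ?_ ?_
  · intro W _ _ p _ ha _
    have h0 : W.analyticRank = W.mordellWeilRank := hS W inferInstance
    have h2 : W.selmerCorank p = W.mordellWeilRank + W.shaCorank p :=
      W.selmerCorank_eq_mordellWeilRank_add_holds p
    have h3 : W.shaCorank p = 0 := Literature.BSD.shaCorank_eq_zero_of_finite W p (hSha W p)
    omega
  · intro W _ ha
    have h0 : W.analyticRank = W.mordellWeilRank := hS W inferInstance
    omega

end Summit.BirchSwinnertonDyer.BirchSwinnertonDyer.Theorems.DerivedKatoValuationDoor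

end
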